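import Literature.MathematicalPhysics.QuantumFieldTheory.Balaban1983to89.B16Sect1Backgrounds
import Literature.MathematicalPhysics.QuantumFieldTheory.Balaban1983to89.B16Eq112

/-!
# `Balaban1983to89.B16Sect1AnalyticExt` — T. Bałaban, *Large field renormalization. II. Localization, exponentiation,
and bounds for the 𝐑 operation*, Commun. Math. Phys. **122** (1989) 355–392 [Balaban1989LargeFieldII], Sect. 1
pp. 366–367 and 372–374: the ANALYTIC EXTENSION of `U₀^{(AL)}` through the identity (1.38), the variational problem
(1.39), its equation (1.40), the formula (1.42), the extended configuration (1.43) and its averages (1.44); and the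
LOCALIZATION REPRESENTATIONS (1.59), (1.61), (1.62), (1.63), (1.64) of the backgrounds `U⁰_k`, `U₁`, `U_{k,Λ}` — typed over
the determining-set calculus of `…B15DeterminingSets` and the chart vocabulary of `…B16Sect1Backgrounds`; (1.40) ⇔ its
variational form, (1.43), (1.59) and (1.64) PROVED from their printed inputs

statement-level skeleton of published theorems with citation tags; proofs where landed; nothing here is a claim about
the Yang–Mills mass gap

PDF held: `paper:balaban1989-cmp122-large-field-ii` (journal page = PDF page + 354); [I] = [Balaban1987RG1], [IV] =
[Balaban1989LargeFieldI], [III] = [Balaban1988Convergent], [15] = [Balaban1985Variational], [12] = [Balaban1985Averaging].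
Every quotation below was READ AS AN IMAGE by this seat on the x2 renders
`run/shared/lean/pub/pub-balaban/b2b-balaban-ref1/pages/1989-cmp122-large-field-II/…-p012,p013,p018,p019,p020-x2.png`
(pp. 366, 367, 372, 373, 374).

CITATION HEADER / WHAT IS REPRODUCED (mega-formalization `lit-balaban`, reader/typer r13 gen 4; HOME
`run/shared/lean/pub/lit-balaban/`, rows `lit-balaban-r13/ROWS-B16.md` v2.5): SKELETON rows **B16.Eq1.38, B16.Eq1.39,
B16.Eq1.40 (display), B16.Eq1.42, B16.Eq1.43, B16.Eq1.44, B16.Eq1.59, B16.Eq1.61, B16.Eq1.62, B16.Eq1.63, B16.Eq1.64**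
(all `absent` at SKELETON v3.18 except (1.40), whose contraction kernel is proved-existing).

PART A (pp. 366–367) works at the SCALE `k` (the fields `V_k`, the `k`-th averages `M^k(𝐔)`, the minimizer `V_Λ` of
[IV] Prop. 1 and the two-slot map `U_{k,Z}(·, ·)` of [IV] (1.74)/(1.77)): the data are the structure `ExtData` (ref-1
F6: every object the displays name is an explicit field — the solution map `U(𝐁_k(Z), ·)` (`B15DeterminingSets.bgKZ`),
`Q_k^{s*}`, the bond set of `Λ`, `V ↦ V_Λ(V)`, `U′ ↦ M̃^k(U′)`, `(Ṽ′, V) ↦ V′_Λ`, the domain of pairs `𝐔 = U′U`); the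
complex group `Gᶜ` is the SAME `GaugeGroup` carrier (`Setup` DIVERGENCE F4: *"or a neighbourhood of it in Gᶜ"*).
(1.38) and the factorisation `M^k(𝐔) = M̃^k(U′)M^k(U)` are `Prop`s (*"Of course the identity is a definition of this
function, so the bounds are important"* — the bounds are rows B16.Eq1.41/1.45 of `…B16Sect1Statements`); (1.39) is a
real `def` (the functional) plus a `Prop` (criticality along the chart, `HasDerivAt … 0 0`); **(1.40)** is PROVED
equivalent to its variational equation as the instance of the tree's `B16Eq112.eq112_iff_eq113` with the source
`Δ₁H_{1,k}B̃′` and the shifted `V`-derivative; (1.42) is a real `def`; **(1.43)** (second member) is PROVED from (1.38)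
and the factorisation; (1.44) is a `Prop` over the explicit `M̃^j`, `U′_{k,Z}`.
PART B (pp. 372–374) is written over `…B16Sect1Backgrounds.Sect1Data`: **(1.59)** is PROVED from the □₀-localized form
of the term ([I] (3.3)/(3.18)/(3.19)), the representation (1.51), the averaged chart identity of [12] (26) defining `Q˙`,
the gauge covariances [12] (11)/[15] (181) and the gauge invariance of `𝐄^{(j)}(X, ·, z)` — each a hypothesis named as
printed; (1.61)–(1.63) are the reproducing identities plus the four-, four- and three-piece spliced data AS PRINTED, the
boundary-layer composite `((u)₋⁻¹ exp iQ̃˙(η𝐇)R((u)₊)M˙(·))` being ONE explicit argument `W` (its [12] (26)/(106)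
structure is not modelled), with the one-line derivation `repr_of_repro` (reproducing identity + locality of `U(𝐁, ·)`
in its datum + agreement of the data on `𝐁`); **(1.64)** is PROVED from `V′_k = V_k(V_Λ^{(A)})⁻¹`.
No `sorry`, no axiom; nothing printed is asserted as a fact.

v1.1 (APPEND-ONLY Part C, r13 gen 100, 2026-08-23; READING RULE FOR DEFINITION DISPLAYS, owner audit
`lit-balaban-r13/READING-RULE-AUDIT-B16-g100.md` §4 row B16.Eq1.38): p. 366 says of (1.38) *"Of course the identity is a
definition of this function"* — Part C gives `V′_Λ` THAT BODY (`ExtData.VΛ'138 Ṽ′ V := V_Λ(Ṽ′V)·V_Λ(V)⁻¹` bondwise) and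
the instance `with138` (the free field `VΛ'` := that body), at which **(1.38) is PROVED** from the factorisation
`M^k(𝐔) = M̃^k(U′)M^k(U)` of the preceding sentence (`Fact138M`, [12] (26), the one named hypothesis) — `eq138_with138` —
and (1.43) follows with the same single hypothesis (`eq143_with138`).  Parts A–B are byte-identical to v1.0.
-/

open Set

namespace Literature.MathematicalPhysics.QuantumFieldTheory.Balaban1983to89.B16Sect1AnalyticExt

open B16Sect1Backgrounds B15DeterminingSets GaugeField

variable {P : Params}

/-! ## Part A. (1.38)–(1.44): the analytic extension of `U₀^{(AL)}` at the scale `k` -/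

/-- The DATA of pp. 366–367 (explicit carriers, ref-1 F6): `bg` = the solution map `U(𝐁, ·)` ([III] (2.12)); `ch` = the
exponential chart; `k`; `BkZ` = `𝐁_k(Z)`; `Qs` = `Q_k^{s*}` ([IV] (1.74)); `Λb` = the bonds of `Λ` ([IV] p. 195: bonds
crossing `∂Λ` included); `VΛmap` = `V_k ↦ V_Λ(V_k↾_{Z∩Λᶜ})` extended by `V_k` off `Λ` ([IV] Prop. 1, p. 195);
`Mt` = `U′ ↦ M̃^k(U′) = exp iQ̃_k(ηA′)` (p. 366); `VΛ'` = `(Ṽ′, V) ↦ V′_Λ(Ṽ′)` (the function DEFINED by (1.38)/(1.39), its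
second argument `V = M^k(U)` suppressed in print); `dom` = the pairs `(U′, U)` with `𝐔 = U′U ∈ 𝐔ᶜ_k(Z, α_{0,k}, α_{1,k})`
(p. 366: *"U is a G-valued configuration satisfying the regularity condition |∂U − 1| < α_{0,k}η², and U′ = exp iηA′,
where A′ is a 𝐠ᶜ-valued function satisfying the bounds |A′|, |∇^η_UA′| < α_{1,k}"*). [cite: Balaban1989LargeFieldII, (1.38) p.366] -/
structure ExtData (P : Params) (G : Type*) [GaugeGroup G] (av : ∀ i, Averaging P i G) (𝔤 : Type*)
    [AddCommGroup 𝔤] [Module ℝ 𝔤] where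
  bg : DetBackground P G av
  ch : ExpChart G 𝔤
  k : ℕ
  BkZ : DetSet P
  Qs : GaugeField P k G → GaugeField P 0 G
  Λb : Set (PBond P k)
  VΛmap : GaugeField P k G → GaugeField P k G
  Mt : GaugeField P 0 G → GaugeField P k G
  VΛ' : GaugeField P k G → GaugeField P k G → GaugeField P k G
  dom : Set (GaugeField P 0 G × GaugeField P 0 G)

namespace ExtData

noncomputable section

variable {G : Type*} [GaugeGroup G] {av : ∀ i, Averaging P i G} {𝔤 : Type*} [AddCommGroup 𝔤] [Module ℝ 𝔤]
variable (E : ExtData P G av 𝔤)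

open Classical in
/-- The two-slot argument `(W↾_{Z∩Λᶜ}, X↾_Λ)` of `U_{k,Z}(·, ·)` (p. 366: *"U₀^{(AL)} = U^{(L)}_{k,Z}(V_k↾_{Z∩Λᶜ}, V_Λ(V_k↾_{Z∩Λᶜ}))"*):
the scale-`k` field equal to `X` on the bonds of `Λ` and to `W` elsewhere. [cite: Balaban1989LargeFieldII, (1.38) p.366] -/
def twoSlot (W X : GaugeField P E.k G) : GaugeField P E.k G := fun b => if b ∈ E.Λb then X b else W b

/-- `U_{k,Z}(W↾_{Z∩Λᶜ}, X↾_Λ) = U(𝐁_k(Z), M˙(Q_k^{s*}(W, X)))` — the [IV] (1.74)/(1.77) map (`B15DeterminingSets.bgKZ`) at the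
two-slot field. [cite: Balaban1989LargeFieldII, (1.39) p.366] -/
def UkZ2 (W X : GaugeField P E.k G) : GaugeField P 0 G := bgKZ E.bg E.BkZ E.Qs (E.twoSlot W X)

/-- `M^k` (`Setup.Averaging.iter`). [cite: Balaban1989LargeFieldII, (1.38) p.366] -/
def Mk : GaugeField P 0 G → GaugeField P E.k G := Averaging.iter av E.k

/-- p. 366, verbatim: *"The extension is constructed by replacing in U₀^{(AL)} = U^{(L)}_{k,Z}(V_k↾_{Z∩Λᶜ}, V_Λ(V_k↾_{Z∩Λᶜ}))
the variables V_k by M^k(𝐔), where 𝐔 ∈ 𝐔ᶜ_k(Z, α_{0,k}, α_{1,k})"* — the displayed (unnumbered) formula as a function of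
`V_k`. [cite: Balaban1989LargeFieldII, (1.38) p.366] -/
def U0AL (Vk : GaugeField P E.k G) : GaugeField P 0 G := E.UkZ2 Vk (E.VΛmap Vk)

/-- p. 366, verbatim: *"By the definition we have 𝐔 = U′U … We write M^k(𝐔) = M̃^k(U′)M^k(U), and M̃^k(U′) = exp iQ̃_k(ηA′) =
exp iB̃′, |B̃′| < O(1)α_{1,k}"* — the FACTORISATION of the `k`-th average of `𝐔 = U′U` ([12] (26)), as a `Prop` over
the explicit `M̃^k` (`Mt`); its content defines `Q̃_k` and is not asserted. [cite: Balaban1989LargeFieldII, (1.38) p.366] -/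
def Fact138M : Prop := ∀ UU ∈ E.dom, E.Mk (mulCfg UU.1 UU.2) = mulCfg (E.Mt UU.1) (E.Mk UU.2)

/-- **(1.38)** p. 366 [PDF 12], verbatim: *"We would like to establish an identity of the form V_Λ(M^k(𝐔)) =
V′_Λ(M̃^k(U′))V_Λ(M^k(U)), (1.38) holding in the axial gauge, and to prove analyticity properties and bounds for the
function V′_Λ. Of course the identity is a definition of this function, so the bounds are important."* — as a `Prop`
over `ExtData` (bondwise product `mulCfg`). [cite: Balaban1989LargeFieldII, (1.38) p.366] -/
def Eq138 : Prop :=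
  ∀ UU ∈ E.dom, E.VΛmap (E.Mk (mulCfg UU.1 UU.2)) = mulCfg (E.VΛ' (E.Mt UU.1) (E.Mk UU.2)) (E.VΛmap (E.Mk UU.2))

/-- **(1.39)** p. 366 [PDF 12], the functional, verbatim: *"The function V′_Λ is determined as a critical point of the
function V′↾_Λ → A(U_{k,Z}(Ṽ′V, V′V_Λ(V))), (1.39) where V′ = exp iB′, and B′ is sufficiently small."* — a real `def`:
`V′ ↦ A(U_{k,Z}(Ṽ′V↾_{Z∩Λᶜ}, V′V_Λ(V)↾_Λ))` (`A` = the `d = 4` Wilson action `Setup.wilsonAction4`).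
[cite: Balaban1989LargeFieldII, (1.39) p.366] -/
def fun139 (Vt' V : GaugeField P E.k G) : GaugeField P E.k G → ℝ :=
  fun V' => wilsonAction4 (E.UkZ2 (mulCfg Vt' V) (mulCfg V' (E.VΛmap V)))

/-- CRITICALITY along the chart: all directional derivatives of `f` at `V′` along `t ↦ exp(itδB)·V′` vanish at `t = 0`
(the meaning of *"critical point"* for `V′ = exp iB′` on p. 366). [cite: Balaban1989LargeFieldII, (1.39) p.366] -/
def IsCritAt (f : GaugeField P E.k G → ℝ) (V' : GaugeField P E.k G) : Prop :=
  ∀ δB : VecField P E.k 𝔤, HasDerivAt (fun t : ℝ => f (expMul E.ch (t • δB) V')) 0 0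

/-- **(1.39)**, the defining property of `V′_Λ`: at every `𝐔 = U′U` of the domain, `V′_Λ(M̃^k(U′))` is a critical point of
the function (1.39) with `Ṽ′ = M̃^k(U′)`, `V = M^k(U)`. [cite: Balaban1989LargeFieldII, (1.39) p.366] -/
def Def139 : Prop :=
  ∀ UU ∈ E.dom, E.IsCritAt (E.fun139 (E.Mt UU.1) (E.Mk UU.2)) (E.VΛ' (E.Mt UU.1) (E.Mk UU.2))

/-- **(1.42)** p. 367 [PDF 13], verbatim: *"This yields the formula V′_Λ(M̃^k(U′)) = exp iB′_Λ((1/i) log M̃^k(U′)) (1.42) for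
the function in the identity (1.38)"* — a real `def` over the solution map `BΛ = B̃′ ↦ B′_Λ(B̃′)` of (1.40) (its existence,
analyticity and bound (1.41) are row B16.Eq1.41): `W ↦ exp iB′_Λ((1/i) log W)`. [cite: Balaban1989LargeFieldII, (1.42) p.367] -/
def VΛ142 (BΛ : VecField P E.k 𝔤 → VecField P E.k 𝔤) (W : GaugeField P E.k G) : GaugeField P E.k G :=
  expMul E.ch (BΛ fun b => E.ch.ilog (W b)) 1

/-- (1.42) as the statement that the function `V′_Λ` of (1.38) IS given by the formula, on the domain.
[cite: Balaban1989LargeFieldII, (1.42) p.367] -/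
def Eq142 (BΛ : VecField P E.k 𝔤 → VecField P E.k 𝔤) : Prop :=
  ∀ UU ∈ E.dom, E.VΛ' (E.Mt UU.1) (E.Mk UU.2) = E.VΛ142 BΛ (E.Mt UU.1)

/-- **(1.43)**, first member, p. 367 [PDF 13], verbatim: *"Consider now the extended function U₀(𝐔) = U_{k,Z}(M^k(𝐔),
V_Λ(M^k(𝐔)))"* — a real `def` (`𝐔 = U′U` as the pair `(U′, U)`). [cite: Balaban1989LargeFieldII, (1.43) p.367] -/
def U0ext (UU : GaugeField P 0 G × GaugeField P 0 G) : GaugeField P 0 G :=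
  E.UkZ2 (E.Mk (mulCfg UU.1 UU.2)) (E.VΛmap (E.Mk (mulCfg UU.1 UU.2)))

/-- `U₀(U) = U_{k,Z}(M^k(U), V_Λ(M^k(U)))` — the un-extended configuration in (1.44). [cite: Balaban1989LargeFieldII, (1.44) p.367] -/
def U0real (U : GaugeField P 0 G) : GaugeField P 0 G := E.UkZ2 (E.Mk U) (E.VΛmap (E.Mk U))

/-- **(1.43)**, second member, PROVED: *"= U_{k,Z}(M̃^k(U′)M^k(U), V′_Λ(M̃^k(U′))V_Λ(M^k(U))) (1.43) in the axial gauge"* —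
from the factorisation `M^k(𝐔) = M̃^k(U′)M^k(U)` and (1.38). [cite: Balaban1989LargeFieldII, (1.43) p.367] -/
theorem eq143 (hM : E.Fact138M) (h38 : E.Eq138) {UU : GaugeField P 0 G × GaugeField P 0 G} (hUU : UU ∈ E.dom) :
    E.U0ext UU = E.UkZ2 (mulCfg (E.Mt UU.1) (E.Mk UU.2))
      (mulCfg (E.VΛ' (E.Mt UU.1) (E.Mk UU.2)) (E.VΛmap (E.Mk UU.2))) := by
  unfold U0ext
  rw [h38 UU hUU, hM UU hUU]

/-- **(1.44)**, the defined factor, p. 367 [PDF 13]: `Ṽ_{j,Z}(W) := M̃^j(U′_{k,Z}(W, V′_Λ(W)))` — over the explicit `M̃^j`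
(`Mtj`, the `U′`-part of the `j`-th average of a product, [12] (26)) and the `U′`-part `U′_{k,Z}(·, ·)` of the extended
two-slot map (`UkZp`). [cite: Balaban1989LargeFieldII, (1.44) p.367] -/
def Vt144 {j : ℕ} (Mtj : GaugeField P 0 G → GaugeField P j G)
    (UkZp : GaugeField P E.k G → GaugeField P E.k G → GaugeField P 0 G)
    (VΛ1 : GaugeField P E.k G → GaugeField P E.k G) (W : GaugeField P E.k G) : GaugeField P j G :=
  Mtj (UkZp W (VΛ1 W))

/-- **(1.44)** p. 367 [PDF 13], verbatim: *"From these results it follows also that a jᵗʰ average of the above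
configuration can be represented in the form M^j(U₀(𝐔)) = M̃^j(U′_{k,Z}(M̃^k(U′), V′_Λ(M̃^k(U′))))M^j(U₀(U)) =
Ṽ_{j,Z}(M̃^k(U′))M^j(U₀(U)), (1.44) where Ṽ_{j,Z}(V′) is an analytic function of (1/i) log V′, satisfying the bound
(1.45)"* — as a `Prop` (the bound is row B16.Eq1.45, `B16Sect1Statements`). [cite: Balaban1989LargeFieldII, (1.44) p.367] -/
def Eq144 (j : ℕ) (Mtj : GaugeField P 0 G → GaugeField P j G)
    (UkZp : GaugeField P E.k G → GaugeField P E.k G → GaugeField P 0 G) : Prop :=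
  ∀ UU ∈ E.dom, Averaging.iter av j (E.U0ext UU) =
    mulCfg (E.Vt144 Mtj UkZp (fun W => E.VΛ' W (E.Mk UU.2)) (E.Mt UU.1)) (Averaging.iter av j (E.U0real UU.2))

end

end ExtData

/-! ### (1.40): the equation for `B′_Λ(B̃′)` -/

section Eq140

open scoped RealInnerProductSpace

variable {E F : Type*} [NormedAddCommGroup E] [InnerProductSpace ℝ E] [NormedAddCommGroup F] [InnerProductSpace ℝ F]

/-- **(1.40)** p. 367 [PDF 13], verbatim: *"The expansion has the same form as the one in the exponentials in (1.2),
only with ζ₀ = 1 and g_k = 1. Differentiating it with respect to B′, using the criticality condition for U₀ = U_{k,Z}(V,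
V_Λ(V)), and inverting the linear operator as in (1.13), we obtain the equation B′ + (P₀H*_{1,k}Δ₁H_{1,k}P₀)⁻¹P₀H*_{1,k}
((δ/δA)V)(H_{1,k}B′ + H_{1,k}B̃′) = −(P₀H*_{1,k}Δ₁H_{1,k}P₀)⁻¹P₀H*_{1,k}Δ₁H_{1,k}B̃′. (1.40)"* — PROVED equivalent to the
differentiated expansion (the (1.12)-type variational equation with the source `Δ₁H_{1,k}B̃′` and the `V`-derivative taken
at `H_{1,k}B′ + H_{1,k}B̃′`), in the gauge subspace `P₀` and with `(P₀H*Δ₁HP₀)⁻¹ = Kinv` inverted on that subspace, as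
the instance of `B16Eq112.eq112_iff_eq113` (carriers as there; the *"exactly one solution"* sentence and (1.41) are
`B16Sect1Kernels.fixedPoint_twice_bound` / row B16.Eq1.41). [cite: Balaban1989LargeFieldII, (1.40) p.367] -/
theorem eq140_iff {P₀ : E →ₗ[ℝ] E} (hP2 : ∀ x, P₀ (P₀ x) = P₀ x) (hPsa : ∀ x y, ⟪P₀ x, y⟫ = ⟪x, P₀ y⟫)
    (H : E →ₗ[ℝ] F) (Hst : F →ₗ[ℝ] E) (Δ₁ : F →ₗ[ℝ] F) (dV : F → F) (Bt : E) {Kinv : E →ₗ[ℝ] E}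
    (hKl : ∀ x, Kinv (P₀ (Hst (Δ₁ (H (P₀ x))))) = P₀ x) (hKr : ∀ x, P₀ (Hst (Δ₁ (H (P₀ (Kinv x))))) = P₀ x)
    (hKP : ∀ x, Kinv (P₀ x) = Kinv x) {B : E} (hB : P₀ B = B) :
    (∀ δB : E, P₀ δB = δB →
        ⟪δB, Hst (Δ₁ (H Bt))⟫ + ⟪δB, Hst (Δ₁ (H B))⟫ + ⟪δB, Hst (dV (H B + H Bt))⟫ = 0) ↔
      B + Kinv (P₀ (Hst (dV (H B + H Bt)))) = -Kinv (P₀ (Hst (Δ₁ (H Bt)))) :=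
  B16Eq112.eq112_iff_eq113 hP2 hPsa H Hst Δ₁ (fun A => dV (A + H Bt)) (Δ₁ (H Bt)) hKl hKr hKP hB

end Eq140

/-! ## Part B. (1.59), (1.61)–(1.64): the localization representations of `U⁰_k`, `U₁`, `U_{k,Λ}` -/

namespace Sect1Data

noncomputable section

variable {G : Type*} [GaugeGroup G] {av : ∀ i, Averaging P i G} {𝔤 : Type*} [AddCommGroup 𝔤] [Module ℝ 𝔤]
variable (D : Sect1Data P G av 𝔤)

/-! ### (1.59) -/

/-- **(1.59)** p. 372 [PDF 18], verbatim: *"Consider a term 𝐄^{(j)}(X, U″_k, z) with X ⊂ Zᶜ, and let z ∈ Ω_n∖Ω_{n+1} for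
n ≥ j. As in Sect. 3 we take the cube □ ∈ π_n containing the point z, and we consider the case X ⊂ □˜². Using a somewhat
simplified version of the transformation (3.3), (3.18), (3.19) [I] we write 𝐄^{(j)}(X, U″_k, z) = 𝐄^{(j)}(X, U⁰_k, z) +
[𝐄^{(j)}(X, U_j(𝐁_j(□₀), exp iQ˙(η𝐇″_k(g_kB))M˙(U⁰_k)), z) − 𝐄^{(j)}(X, U_j(𝐁_j(□₀), M˙(U⁰_k)), z)], (1.59) where □₀ = □˜⁵"*
— for the term `E = 𝐄^{(j)}(X, ·, z)` (values in an additive group), the family (1.50) `U″_k = cfg150 B` and `U⁰_k = bg0k`,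
the representing function `H` of (1.51) (`𝐇″_k`), the localized determining set `detJbox = 𝐁_j(□₀)` (solution map
`bg.U detJbox`), and the averaged chart `Qd = Q˙` of [12] (26) at the background `U⁰_k` — all explicit.
[cite: Balaban1989LargeFieldII, (1.59) p.372] -/
def Eq159 {𝕜 : Type*} [AddCommGroup 𝕜] (E : GaugeField P 0 G → 𝕜) (detJbox : DetSet P)
    (Qd : VecField P 0 𝔤 → MSVecField P 𝔤) (H : MSVecField P 𝔤 → VecField P 0 𝔤) (B : MSVecField P 𝔤) : Prop :=
  E (D.cfg150 B) = E D.bg0k +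
    (E (D.bg.U detJbox (msExpMul D.ch (Qd (D.η • H (D.gk • B))) (avgFamily av D.bg0k))) -
      E (D.bg.U detJbox (avgFamily av D.bg0k)))

/-- **(1.59) PROVED from its printed inputs**, each a hypothesis: `hloc` — the □₀-localized form of the term, *"a
somewhat simplified version of the transformation (3.3), (3.18), (3.19) [I]"*: `𝐄^{(j)}(X, U, z) = 𝐄^{(j)}(X, U_j(𝐁_j(□₀),
M˙(U)), z)`; `h151` — the representation (1.51) at `B ∈ dom`; `h26` — the averaged chart identity of [12] (26) defining `Q˙`
at the background `U⁰_k`, `M˙(exp(iηA)U⁰_k) = exp iQ˙(ηA)M˙(U⁰_k)`; `hM` — gauge covariance of the averages [12] (11); `hU`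
— covariance of the solution map [15] (181) (with the block-constant extension `ubar`); `hE` — gauge invariance of the
term ([I] (1.7)–(1.8)). [cite: Balaban1989LargeFieldII, (1.59) p.372] -/
theorem eq159_of {𝕜 : Type*} [AddCommGroup 𝕜] {E : GaugeField P 0 G → 𝕜} {detJbox : DetSet P}
    {Qd : VecField P 0 𝔤 → MSVecField P 𝔤} {dom : Set (MSVecField P 𝔤)} {H : MSVecField P 𝔤 → VecField P 0 𝔤}
    {u : MSVecField P 𝔤 → GaugeTransf P 0 G} {ubar : GaugeTransf P 0 G → GaugeTransf P 0 G}
    (hloc : ∀ U, E U = E (D.bg.U detJbox (avgFamily av U))) (h151 : D.Repr151 dom H u)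
    (h26 : ∀ A : VecField P 0 𝔤,
      avgFamily av (expMul D.ch A D.bg0k) = msExpMul D.ch (Qd A) (avgFamily av D.bg0k))
    (hM : ∀ (v : GaugeTransf P 0 G) (U : GaugeField P 0 G),
      avgFamily av (gaugeAct v U) = msGaugeAct (toMS v) (avgFamily av U))
    (hU : ∀ (v : GaugeTransf P 0 G) (V : MSField P G),
      D.bg.U detJbox (msGaugeAct (toMS v) V) = gaugeAct (ubar v) (D.bg.U detJbox V))
    (hE : GaugeInvariant E) {B : MSVecField P 𝔤} (hB : B ∈ dom) : Eq159 D E detJbox Qd H B := by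
  unfold Eq159
  have h1 : E (D.cfg150 B) =
      E (D.bg.U detJbox (msExpMul D.ch (Qd (D.η • H (D.gk • B))) (avgFamily av D.bg0k))) := by
    rw [hloc (D.cfg150 B), h151 B hB, hM, hU, hE, h26]
  rw [h1, ← hloc D.bg0k]
  abel

/-! ### (1.61)–(1.63): reproducing identities with spliced data -/

/-- The one-line mechanism behind (1.61)–(1.63): a REPRODUCING identity `U₀ = U(𝐁, M˙(U₀))`, LOCALITY of the solution
map in its datum (*"[III] (2.10): the fields V_j determine the field V defined on 𝐁"* — `U(𝐁, V)` depends on `V` only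
through `V` on `𝐁`), and AGREEMENT of `M˙(U₀)` with a datum `W` on `𝐁` give `U₀ = U(𝐁, W)`.
[cite: Balaban1989LargeFieldII, (1.61) p.373] -/
theorem repr_of_repro {𝔅 : DetSet P} {U₀ : GaugeField P 0 G} {W : MSField P G}
    (hrepro : U₀ = D.bg.U 𝔅 (avgFamily av U₀))
    (hloc : ∀ V V' : MSField P G, AgreeOn 𝔅 V V' → D.bg.U 𝔅 V = D.bg.U 𝔅 V')
    (hagree : AgreeOn 𝔅 (avgFamily av U₀) W) : U₀ = D.bg.U 𝔅 W := by
  rw [hrepro]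
  exact hloc _ _ hagree

/-- The datum of **(1.61)** p. 373: on `(Y₁⁰)ᶜ ∩ Y₁` the boundary-layer composite `W = ((u⁰_k)₋⁻¹ exp iQ̃˙(η𝐇″_k)R((u⁰_k)₊)
M˙(U₁))` (ONE explicit argument: the averaged, gauge-transformed chart representation of [12] (26)/(106) is not modelled);
elsewhere the (1.50) datum at `B = 0` — `V″↾_{Λᶜ∩Y₁⁰}`, `M˙(U₀^{(AL)})↾_{Λ∩Ω″˜²_{h+1}∩Y₁}`, `V″↾_{(Ω″˜²_{h+1})ᶜ∩Y₁}`.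
[cite: Balaban1989LargeFieldII, (1.61) p.373] -/
def data161 (Y1 Y10 : Set (Site P 0)) (W : MSField P G) : MSField P G :=
  splice (Y10ᶜ ∩ Y1) W (splice (D.Λ ∩ D.ΩppT2) (avgFamily av D.U0AL) D.Vpp)

/-- **(1.61), first member** p. 373 [PDF 19], verbatim: *"For the domain Y₁ we take the determining set 𝐁″_k(Y₁) =
𝐁(Y₁)∪𝐁″_k, and the representation U⁰_k = U(𝐁″_k(Y₁), M˙(U⁰_k))"* — the reproducing identity for `U⁰_k = bg0k` and the
explicit determining set `detPPY1 = 𝐁″_k(Y₁)`. [cite: Balaban1989LargeFieldII, (1.61) p.373] -/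
def Repro161 (detPPY1 : DetSet P) : Prop := D.bg0k = D.bg.U detPPY1 (avgFamily av D.bg0k)

/-- **(1.61), second member** p. 373 [PDF 19] (printed "(1.161)", numbering slip), verbatim: *"= U(𝐁″_k(Y₁), ((u⁰_k)₋⁻¹
exp iQ̃˙(η𝐇″_k)R((u⁰_k)₊)M˙(U₁))↾_{(Y₁⁰)ᶜ∩Y₁}, V″↾_{Λᶜ∩Y₁⁰}, M˙(U₀^{(AL)})↾_{Λ∩Ω″˜²_{h+1}∩Y₁}, V″↾_{(Ω″˜²_{h+1})ᶜ∩Y₁}). Here Y₁⁰ is the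
domain on which the determining sets 𝐁″_k(Y₁) and 𝐁″_k coincide, hence Y₁∖Y₁⁰ is a boundary layer at the boundary ∂Y₁, of
the width 2M₁ at most, for the corresponding scale. Notice that we have to keep the gauge transformation u⁰_k in the above
configuration."* [cite: Balaban1989LargeFieldII, (1.61) p.373] -/
def Repr161 (detPPY1 : DetSet P) (Y1 Y10 : Set (Site P 0)) (W : MSField P G) : Prop :=
  D.bg0k = D.bg.U detPPY1 (data161 D Y1 Y10 W)

/-- (1.61) from its inputs: the reproducing identity, locality of `U(𝐁″_k(Y₁), ·)`, and the agreement of `M˙(U⁰_k)` with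
the spliced datum on `𝐁″_k(Y₁)` (the latter = (1.54) averaged by [12] (26)/(106) on the layer, and the constraint of
(1.50) on `Y₁⁰` where *"𝐁″_k(Y₁) and 𝐁″_k coincide"*; one hypothesis). [cite: Balaban1989LargeFieldII, (1.61) p.373] -/
theorem repr161_of {detPPY1 : DetSet P} {Y1 Y10 : Set (Site P 0)} {W : MSField P G}
    (hrepro : Repro161 D detPPY1)
    (hloc : ∀ V V' : MSField P G, AgreeOn detPPY1 V V' → D.bg.U detPPY1 V = D.bg.U detPPY1 V')
    (hagree : AgreeOn detPPY1 (avgFamily av D.bg0k) (data161 D Y1 Y10 W)) : Repr161 D detPPY1 Y1 Y10 W :=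
  repr_of_repro D hrepro hloc hagree

/-- The datum of **(1.62)** p. 373: the composite `W = (u₁)₋⁻¹ exp iQ̃˙(η𝐇_{𝐁₁})R(u_{1,+})M˙(U_{k,Λ})` on `(Y₂⁰)ᶜ ∩ Y₂`, elsewhere
the (1.53) datum of `U₁` (`dataU1`: `V″↾_{Λᶜ}`, `M˙(U₀^{(AL)})↾_{Λ∩Ω″_k}`, `1↾_{Z″_k∩Ω″˜_{h+1}}`). [cite: Balaban1989LargeFieldII, (1.62) p.373] -/
def data162 (Y2 Y20 : Set (Site P 0)) (W : MSField P G) : MSField P G := splice (Y20ᶜ ∩ Y2) W D.dataU1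

/-- **(1.62), first member** p. 373: *"For the domain Y₂ we take the determining set 𝐁₁(Y₂) = 𝐁(Y₂)∪𝐁₁, and the
representation U₁ = U(𝐁₁(Y₂), M˙(U₁))"* (`U₁ = cfgU1`, `detB1Y2 = 𝐁₁(Y₂)`). [cite: Balaban1989LargeFieldII, (1.62) p.373] -/
def Repro162 (detB1Y2 : DetSet P) : Prop := D.cfgU1 = D.bg.U detB1Y2 (avgFamily av D.cfgU1)

/-- **(1.62), second member** p. 373 [PDF 19], verbatim: *"= U(𝐁₁(Y₂), (u₁,₋⁻¹ exp iQ̃˙(η𝐇_{𝐁₁})R(u_{1,+})M˙(U_{k,Λ}))↾_{(Y₂⁰)ᶜ∩Y₂},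
V″↾_{Λᶜ∩Y₂}, M˙(U₀^{(AL)})↾_{Λ∩Ω″_k}, 1↾_{Z″_k∩Ω″˜_{h+1}}), (1.62) where we have used the expansion (1.57)."*
[cite: Balaban1989LargeFieldII, (1.62) p.373] -/
def Repr162 (detB1Y2 : DetSet P) (Y2 Y20 : Set (Site P 0)) (W : MSField P G) : Prop :=
  D.cfgU1 = D.bg.U detB1Y2 (data162 D Y2 Y20 W)

/-- (1.62) from its inputs (as `repr161_of`). [cite: Balaban1989LargeFieldII, (1.62) p.373] -/
theorem repr162_of {detB1Y2 : DetSet P} {Y2 Y20 : Set (Site P 0)} {W : MSField P G}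
    (hrepro : Repro162 D detB1Y2)
    (hloc : ∀ V V' : MSField P G, AgreeOn detB1Y2 V V' → D.bg.U detB1Y2 V = D.bg.U detB1Y2 V')
    (hagree : AgreeOn detB1Y2 (avgFamily av D.cfgU1) (data162 D Y2 Y20 W)) : Repr162 D detB1Y2 Y2 Y20 W :=
  repr_of_repro D hrepro hloc hagree

/-- The datum of **(1.63)** p. 374: the composite `W = ((u_{k,Λ})₋⁻¹ exp iQ̃˙(η𝐇_k)R((u_{k,Λ})₊)M˙(U_k))` on `(Y₃⁰)ᶜ ∩ Y₃`,
elsewhere the (1.56) datum of `U_{k,Λ}` (`V″↾_{Λᶜ}`, `V_Λ^{(A)}`). [cite: Balaban1989LargeFieldII, (1.63) p.374] -/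
def data163 (Y3 Y30 : Set (Site P 0)) (W : MSField P G) : MSField P G :=
  splice (Y30ᶜ ∩ Y3) W (splice D.Λᶜ D.Vpp D.VΛA)

/-- **(1.63), first member** p. 374: *"we take the determining set 𝐁_k(Y₃) = 𝐁(Y₃)∪𝐁_k, and the representation U_{k,Λ} =
U(𝐁_k(Y₃), M˙(U_{k,Λ}))"* (`U_{k,Λ} = cfgKΛ`, `detKY3 = 𝐁_k(Y₃)`). [cite: Balaban1989LargeFieldII, (1.63) p.374] -/
def Repro163 (detKY3 : DetSet P) : Prop := D.cfgKΛ = D.bg.U detKY3 (avgFamily av D.cfgKΛ)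

/-- **(1.63), second member** p. 374 [PDF 20], verbatim: *"= U(𝐁_k(Y₃), ((u_{k,Λ})₋⁻¹ exp iQ̃˙(η𝐇_k)R((u_{k,Λ})₊)M˙(U_k))
↾_{(Y₃⁰)ᶜ∩Y₃}, V″↾_{Λᶜ∩Y₃}, V_Λ^{(A)}), (1.63) where we have used the expansion (1.58)."* [cite: Balaban1989LargeFieldII, (1.63) p.374] -/
def Repr163 (detKY3 : DetSet P) (Y3 Y30 : Set (Site P 0)) (W : MSField P G) : Prop :=
  D.cfgKΛ = D.bg.U detKY3 (data163 D Y3 Y30 W)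

/-- (1.63) from its inputs (as `repr161_of`). [cite: Balaban1989LargeFieldII, (1.63) p.374] -/
theorem repr163_of {detKY3 : DetSet P} {Y3 Y30 : Set (Site P 0)} {W : MSField P G}
    (hrepro : Repro163 D detKY3)
    (hloc : ∀ V V' : MSField P G, AgreeOn detKY3 V V' → D.bg.U detKY3 V = D.bg.U detKY3 V')
    (hagree : AgreeOn detKY3 (avgFamily av D.cfgKΛ) (data163 D Y3 Y30 W)) : Repr163 D detKY3 Y3 Y30 W :=
  repr_of_repro D hrepro hloc hagree

/-! ### (1.64) -/

/-- **(1.64)** p. 374 [PDF 20], verbatim: *"where we have used the expansion (1.58). Here the function 𝐇_k is given by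
𝐇_k = 𝐇_k(−(1/i) log V′_k↾_Λ) = 𝐇_k(−(1/i) log V_k(V_Λ^{(A)})⁻¹↾_Λ). (1.64)"* — for the function `Hk` of (1.58) at its
argument `arg158 = −(1/i) log V′_k↾_Λ`, with `Vk` the multi-scale field whose scale-`k` member is `V_k`.
[cite: Balaban1989LargeFieldII, (1.64) p.374] -/
def Eq164 (Hk : MSVecField P 𝔤 → VecField P 0 𝔤) (Vk : MSField P G) : Prop :=
  Hk D.arg158 = Hk (msRestrict D.Λ (-msILog D.ch (msMul Vk (msInv D.VΛA))))

/-- **(1.64) PROVED** from the relation `V′_k = V_k(V_Λ^{(A)})⁻¹` between the variables (1.34) and the axial-gauge minimizer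
(p. 378: *"V′_k = V_k(V_Λ)⁻¹"*; hypothesis `hVk'`). [cite: Balaban1989LargeFieldII, (1.64) p.374] -/
theorem eq164_of (Hk : MSVecField P 𝔤 → VecField P 0 𝔤) {Vk : MSField P G}
    (hVk' : D.Vk' = msMul Vk (msInv D.VΛA)) : Eq164 D Hk Vk := by
  unfold Eq164
  rw [show D.arg158 = msRestrict D.Λ (-msILog D.ch D.Vk') from rfl, hVk']

end

end Sect1Data


/-! ## Part C (v1.1, APPEND-ONLY). (1.38): `V′_Λ` WITH ITS BODY — *"the identity is a definition of this function"* -/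

namespace ExtData

noncomputable section

variable {G : Type*} [GaugeGroup G] {av : ∀ i, Averaging P i G} {𝔤 : Type*} [AddCommGroup 𝔤] [Module ℝ 𝔤]
variable (E : ExtData P G av 𝔤)

/-- Bondwise group law at one scale: `[W·V⁻¹]·V = W` (the algebra that makes (1.38) an identity once `V′_Λ` carries its
body). [cite: Balaban1989LargeFieldII, (1.38) p.366] -/
theorem mulCfg_mulCfg_invCfg {j : ℕ} (W V : GaugeField P j G) : mulCfg (mulCfg W (invCfg V)) V = W := by
  funext b
  simp [mulCfg, invCfg]

/-- **(1.38) as the DEFINITION it is**, p. 366 [PDF 12], verbatim: *"We would like to establish an identity of the form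
V_Λ(M^k(𝐔)) = V′_Λ(M̃^k(U′))V_Λ(M^k(U)), (1.38) holding in the axial gauge … Of course the identity is a definition of this
function, so the bounds are important."* — `V′_Λ(Ṽ′; V) := V_Λ(Ṽ′·V)·(V_Λ(V))⁻¹` bondwise (print suppresses the second
argument `V = M^k(U)`; `Ṽ′ = M̃^k(U′)`), over the data `VΛmap = V ↦ V_Λ(V)` of [IV] Prop. 1. [cite: Balaban1989LargeFieldII, (1.38) p.366] -/
def VΛ'138 (Vt V : GaugeField P E.k G) : GaugeField P E.k G :=
  mulCfg (E.VΛmap (mulCfg Vt V)) (invCfg (E.VΛmap V))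

/-- The data record with its free field `VΛ'` REPLACED by the body (1.38) gives it; every other field unchanged.
[cite: Balaban1989LargeFieldII, (1.38) p.366] -/
def with138 : ExtData P G av 𝔤 := { E with VΛ' := E.VΛ'138 }

/-- The `V′_Λ` of `with138 E` is the (1.38) body (definitional). [cite: Balaban1989LargeFieldII, (1.38) p.366] -/
@[simp] theorem with138_VΛ' : E.with138.VΛ' = E.VΛ'138 := rfl

/-- The factorisation hypothesis does not involve `V′_Λ`: it is the same statement at `with138 E` (definitional).
[cite: Balaban1989LargeFieldII, (1.38) p.366] -/
theorem fact138M_with138 : E.with138.Fact138M ↔ E.Fact138M := Iff.rfl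

/-- **(1.38) PROVED at the instance `with138`** from the ONE printed premise preceding it, *"We write M^k(𝐔) =
M̃^k(U′)M^k(U)"* (`Fact138M`, the factorisation of [12] (26) carried as the named hypothesis): for every `𝐔 = U′U` of the
domain, `V_Λ(M^k(𝐔)) = V′_Λ(M̃^k(U′))·V_Λ(M^k(U))`. [cite: Balaban1989LargeFieldII, (1.38) p.366] -/
theorem eq138_with138 (hM : E.Fact138M) : E.with138.Eq138 := by
  intro UU hUU
  show E.VΛmap (E.Mk (mulCfg UU.1 UU.2)) = mulCfg (E.VΛ'138 (E.Mt UU.1) (E.Mk UU.2)) (E.VΛmap (E.Mk UU.2))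
  rw [VΛ'138, mulCfg_mulCfg_invCfg, hM UU hUU]

/-- **(1.43) at the instance `with138`**: the second member *"= U_{k,Z}(M̃^k(U′)M^k(U), V′_Λ(M̃^k(U′))V_Λ(M^k(U)))"* now rests
on the factorisation alone (the (1.38) input of `eq143` is DISCHARGED by `eq138_with138`). [cite: Balaban1989LargeFieldII, (1.43) p.367] -/
theorem eq143_with138 (hM : E.Fact138M) {UU : GaugeField P 0 G × GaugeField P 0 G} (hUU : UU ∈ E.dom) :
    E.with138.U0ext UU = E.UkZ2 (mulCfg (E.Mt UU.1) (E.Mk UU.2))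
      (mulCfg (E.VΛ'138 (E.Mt UU.1) (E.Mk UU.2)) (E.VΛmap (E.Mk UU.2))) :=
  E.with138.eq143 ((fact138M_with138 E).2 hM) (E.eq138_with138 hM) hUU

/-- At the instance, the (1.39)/(1.42)/(1.44) statements are ABOUT the so-defined function: e.g. (1.42) reads
`V_Λ(Ṽ′V)·V_Λ(V)⁻¹ = exp iB′_Λ((1/i) log Ṽ′)` on the domain (definitional unfolding; the claims themselves stay rows
B16.Eq1.39/1.42/1.44). [cite: Balaban1989LargeFieldII, (1.42) p.367] -/
theorem eq142_with138_iff (BΛ : VecField P E.k 𝔤 → VecField P E.k 𝔤) :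
    E.with138.Eq142 BΛ ↔ ∀ UU ∈ E.dom, E.VΛ'138 (E.Mt UU.1) (E.Mk UU.2) = E.VΛ142 BΛ (E.Mt UU.1) := Iff.rfl

end

end ExtData

end Literature.MathematicalPhysics.QuantumFieldTheory.Balaban1983to89.B16Sect1AnalyticExt
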